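import Mathlib
import Literature.Computability.Complexity.CircuitClasses
import Literature.Computability.Complexity.Promise
import Literature.Computability.MetaComplexity.MCSP
import Literature.Computability.MetaComplexity.FormulaModelsAE
import Literature.Computability.MetaComplexity.EventuallyUnsolvable
import Literature.Computability.MetaComplexity.OliveiraPichSanthanam2019.GapMKtPMagnification
import Literature.Computability.MetaComplexity.ChenJinWilliams2019.SparseConstantDepthMagnification
import Literature.Computability.MetaComplexity.ChenTell2019.WordProblemWires
import HarnessLib

/-!
# Hatami–Hoza–Tal–Tell 2021, Corollary 1.3 and Theorem 6.26 (constant depth): `gapMCSP` versus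
# depth-`d` LTF circuits with `n^{1+δ}` WIRES — the KNOWN side of census row R62 (`pub-magnif`)

Citation header. P. Hatami, W. M. Hoza, A. Tal, R. Tell, *Fooling Constant-Depth Threshold Circuits*,
FOCS 2021, pp. 104–115, doi:10.1109/FOCS52979.2021.00019 [bib: `HatamiHozaTalTell2021`]; quoted from
the full version ECCC TR21-002, revision 1 (held key `paper:galaxy-pdf-7508494228609794180`; the
locators `chunk pNNNN` below are the chunk files of that ingestion, not PDF pages; the proceedings
numbering was not compared — flag recorded in the census, CENSUS.md §T).

Printed, verbatim (chunk p0110 L1–5): *"Let CC(f) denote the size of the smallest Boolean circuit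
computing f. … For two functions s₁, s₂ : ℕ → ℕ such that s₁(n) < s₂(n), let gapMCSP[s₁, s₂] denote
the promise problem where we are given an n-bit truth table of a function f : {0,1}^ℓ → {0,1}, where
n = 2^ℓ, and our goal is to distinguish between the "yes" case CC(f) ≤ s₁(ℓ) and the "no" case
CC(f) ≥ s₂(ℓ), under the promise that one of the two holds."* — *"**Theorem 6.26** (Lower bound for
computing MCSP by LTF circuits). Let d : ℕ → ℕ be a function with d(n) ≤ (1/6) log log n, let
δ(n) = (1/8)·50^{−d(n)}, and assume that d(n) can be computed in time O(n^{1−2δ(n)}) on a multitape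
Turing machine. Let s₁(ℓ) = 2^{(1−δ(2^ℓ))·ℓ}, and let s₂(ℓ) = 2^{ℓ−1}/ℓ. Then for all sufficiently
large ℓ and n = 2^ℓ, depth-d(n) LTF circuits with n^{1+δ(n)} wires cannot solve gapMSCP[s₁, s₂]
[sic] on truth tables of length n."* — (chunk p0008 L5) *"**Corollary 1.3** (MCSP lower bound for
LTF circuits of super-linear size; see Theorem 6.26 for a more general statement). For any constant
d ∈ ℕ it holds that gapMCSP[2^{(1−400^{−d})·ℓ}, 2^{ℓ−1}/ℓ] cannot be decided by LTF circuits of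
depth d with n^{1+400^{−d}} wires."* The model (chunk p0004 L7): *"a linear threshold function (LTF)
is a Boolean function of the form Φ(x) = 1 ⟺ Σᵢ wᵢ·xᵢ > θ, where w ∈ ℝⁿ and θ ∈ ℝ. The class of
constant-depth linear-threshold circuits (LTF circuits) consists of circuits of constant depth whose
gates can compute arbitrary LTFs"*; size = number of wires throughout (Thm. 1.1, chunk p0006 L5:
*"LTF circuits of depth d with at most n^{1+δ} wires"*).

Why the census wants it (R62). The same authors pair this bound with hardness magnification
(chunk p0008 L7): *"The combination of Corollary 1.3 and of recent "hardness magnification" results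
reveals a sharp threshold … [CJW19] … imply that for some constant c > 1, if for all β > 0 it holds
that gapMCSP[2^{β·ℓ}, 2^{ℓ−1}/ℓ] cannot be decided by LTF circuits of depth d′ = 2d with
n^{1+c^{−d′}} wires, then NP is not contained in TC⁰_d[n^k] for any fixed k ∈ ℕ"* (the
magnification side is Chen–Jin–Williams 2019, Thm. 1.1 item 7, in tree as
`ChenJinWilliams2019.thm11_item7_NP`). HONEST FRAMING (census rule): this file is the KNOWN side
(K); the threshold side needs EVERY `β > 0`, print's K has `β = 1 − 400^{−d}` only, and a lower bound
for a SMALLER yes-threshold is the STRONGER statement (`Cor13At.of_yes_le` below transfers the bound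
only UPWARD in the yes-threshold) — a parameter mismatch, recorded in the census, not closed here.

## Rendering (each choice makes the vendored statement a CONSEQUENCE of the printed one)

* `gapMCSP[s₁, s₂]` ↦ the tree's `gapMCSP a b` (`MCSP.lean`; parameters indexed by the number of
  variables `ℓ`; YES side `circuitSizeOver B2 f ≤ a ℓ`, NO side `b ℓ < circuitSizeOver B2 f`). Print's
  NO condition is `CC(f) ≥ s₂(ℓ)`, so `b := noThreshold`, `noThreshold ℓ = ⌈2^{ℓ−1}/ℓ⌉₊ − 1`
  (`noThreshold ℓ < CC ⟺ 2^{ℓ−1}/ℓ ≤ CC` for integer `CC`, `lt_noThreshold_iff`); YES threshold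
  `yesThreshold δ ℓ = ⌊2^{(1−δ)ℓ}⌋₊` (`CC ≤ ⌊x⌋₊ ⟺ CC ≤ x`). Print's `CC` is "the smallest Boolean
  circuit" with the basis unspecified; the tree measures `circuitSizeOver B2` (all fan-in-2 gates).
  The proof has slack on both sides that absorbs any constant-factor basis change: the YES witness has
  `CC ≤ O(n^{1−2δ} log n) ≤ n^{1−δ}` (chunk p0111 L1) and the NO side is Shannon's counting bound
  `CC ≥ 2^{ℓ−1}/ℓ` for half of all functions (chunk p0110 L7, [Sha49]), which holds for `B2` gate
  counts. So the `B2` reading is the printed statement for all large `ℓ`.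
* "depth-`d` LTF circuits with at most `s(n)` wires" ↦ the constraint `IsLTFd d s n C :=
  C.IsOver ltfBasis ∧ C.acDepth ≤ d ∧ C.wires ≤ s n` — literally the datum of the almost-everywhere
  class `ChenJinWilliams2019.TCdWIRESae d s` (`familyAE_isLTFd`, `rfl`): INTEGER-weight threshold
  gates of every arity (`ltfBasis`; a real-weight LTF on finitely many Boolean inputs has an integer
  realisation, so the gate sets coincide as Boolean functions), `acDepth` (negation gates depth-free —
  the admissible class only grows, and a `¬` above an LTF gate is an LTF gate), `Circuit.wires` =
  total fan-in. Wire bound `n^{1+δ}` ↦ `powSize (1 + δ) n = ⌊n^{1+δ}⌋₊`; at `δ = 400^{−d}` this is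
  `ChenTell2019.wireBound 400 d` (`powSize_delta_eq_wireBound`, `rfl`), the base-`c` vocabulary of row
  R44.
* "for all sufficiently large `ℓ` and `n = 2^ℓ`, [no such circuit] solve[s] gapMCSP on truth tables of
  length `n`" ↦ `UnsolvableOnLargeTruthTables Q P := ∀ᶠ ℓ in atTop, ∀ E : Circuit (Fin (2^ℓ)),
  P (2^ℓ) E → ¬ E.SolvesPromise Q` (`Circuit.SolvesPromise` of `EventuallyUnsolvable.lean`). This is
  the POINTWISE (almost-every-length) bound of print, restricted to the lengths `2^ℓ` at which
  `gapMCSP` has instances (at other lengths every circuit solves it vacuously, so the unrestricted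
  `PromiseProblem.EventuallyUnsolvable` would be the wrong — false — reading); it implies the family
  bound `Q ∉ promiseLift (FamilyAE P)` (`UnsolvableOnLargeTruthTables.not_mem_promiseLift`, proved).
* Constants: `δ_d = 400^{−d}` ↦ `delta d = (400 : ℝ)⁻¹ ^ d`; Thm. 6.26's `(1/8)·50^{−d}` ↦
  `delta626 d = (50 : ℝ)⁻¹ ^ d / 8`. Thm. 6.26 is vendored only for CONSTANT depth functions
  `d(n) = d` (computable in constant time, and `d ≤ (1/6) log log n` for all large `n`), which is all
  the census uses; print's "d ∈ ℕ" is read `1 ≤ d` (for `d = 0` both statements are degenerate and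
  Cor. 1.3 would not follow from Thm. 6.26: `400⁰ = 1 > 1/8`).

## What is proved here (elementary)

`familyAE_isLTFd`, `powSize_delta_eq_wireBound` (`rfl`); the unfolding `unsolvableOnLargeTruthTables_iff`;
the pointwise bound implies the family bound (`not_mem_promiseLift`); monotonicity of the bound in the
constraint and UPWARD in the yes-threshold (`Cor13At.anti_wires`, `Cor13At.of_yes_le`); the threshold
arithmetic `delta_le_delta626` (`400^{−d} ≤ 50^{−d}/8` for `d ≥ 1`) and hence **Cor. 1.3 from
Thm. 6.26 as rendered** (`cor13_of_thm626`); non-vacuity of the constraint (`isLTFd_input`).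
-/

noncomputable section

namespace Literature.Computability.MetaComplexity.HatamiHozaTalTell2021

open Filter Literature.Computability.Complexity Literature.Computability.MetaComplexity
open ChenJinWilliams2019 OliveiraPichSanthanam2019

/-! ### Thresholds, constants and the circuit constraint -/

/-- `δ_d = 400^{−d}`, the second-order exponent of Cor. 1.3. [cite: HatamiHozaTalTell2021, Cor. 1.3 (n^{1+400^{−d}} wires)] -/
def delta (d : ℕ) : ℝ := (400 : ℝ)⁻¹ ^ d

/-- `δ(n) = (1/8)·50^{−d}` of Thm. 6.26 at constant depth `d`. [cite: HatamiHozaTalTell2021, Thm. 6.26 (δ(n) = (1/8)·50^{−d(n)})] -/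
def delta626 (d : ℕ) : ℝ := (50 : ℝ)⁻¹ ^ d / 8

/-- YES threshold `s₁(ℓ) = 2^{(1−δ)·ℓ}`, rendered `⌊2^{(1−δ)ℓ}⌋₊` (exact for the integer `CC`).
[cite: HatamiHozaTalTell2021, Thm. 6.26 (s₁(ℓ) = 2^{(1−δ(2^ℓ))·ℓ})] -/
def yesThreshold (δ : ℝ) (ℓ : ℕ) : ℕ := ⌊(2 : ℝ) ^ ((1 - δ) * ℓ)⌋₊

/-- NO threshold: print's NO case is `CC(f) ≥ s₂(ℓ) = 2^{ℓ−1}/ℓ`; the tree's `gapMCSP a b` has NO side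
`b ℓ < CC(f)`, so `b ℓ := ⌈2^{ℓ−1}/ℓ⌉₊ − 1` (`lt_noThreshold_iff`).
[cite: HatamiHozaTalTell2021, Thm. 6.26 (s₂(ℓ) = 2^{ℓ−1}/ℓ)] -/
def noThreshold (ℓ : ℕ) : ℕ := ⌈(2 : ℝ) ^ ((ℓ : ℝ) - 1) / ℓ⌉₊ - 1

/-- The promise problem `gapMCSP[2^{(1−δ)ℓ}, 2^{ℓ−1}/ℓ]` of Cor. 1.3 / Thm. 6.26 in the tree's `gapMCSP`.
[cite: HatamiHozaTalTell2021, Cor. 1.3 (gapMCSP[2^{(1−400^{−d})·ℓ}, 2^{ℓ−1}/ℓ])] -/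
def gapProblem (δ : ℝ) : PromiseProblem := gapMCSP (yesThreshold δ) noThreshold

/-- **Depth-`d` LTF circuits with at most `s(n)` wires**, as a constraint on `n`-input circuits: gates
from `ltfBasis`, `acDepth ≤ d`, `wires ≤ s n` — the datum of `TCdWIRESae d s` (`familyAE_isLTFd`).
[cite: HatamiHozaTalTell2021, Cor. 1.3 ("LTF circuits of depth d with n^{1+400^{−d}} wires")] -/
def IsLTFd (d : ℕ) (s : ℕ → ℕ) (n : ℕ) (C : Circuit (Fin n)) : Prop :=
  C.IsOver ltfBasis ∧ C.acDepth ≤ d ∧ C.wires ≤ s n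

/-- `FamilyAE (IsLTFd d s)` is literally `TCdWIRESae d s`. [folklore] -/
theorem familyAE_isLTFd (d : ℕ) (s : ℕ → ℕ) : FamilyAE (IsLTFd d s) = TCdWIRESae d s := rfl

/-- At `δ = 400^{−d}` the wire bound `⌊n^{1+δ}⌋₊` is Chen–Tell's `wireBound 400 d` (row R44's base-`c`
vocabulary, `c = 400`). [folklore] -/
theorem powSize_delta_eq_wireBound (d : ℕ) : powSize (1 + delta d) = ChenTell2019.wireBound 400 d := rfl

/-! ### "For all large `ℓ`, no admissible `2^ℓ`-input circuit solves `Q`" -/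

/-- **Pointwise lower bound on truth-table lengths**: for all sufficiently large `ℓ`, no circuit
`E : Circuit (Fin (2^ℓ))` satisfying the constraint `P (2^ℓ) E` solves the promise problem `Q` at
length `2^ℓ` — print's *"for all sufficiently large ℓ and n = 2^ℓ, … cannot solve gapMCSP[s₁, s₂] on
truth tables of length n"*. (Restricting to the lengths `2^ℓ` matters: `gapMCSP` has no instances of
other lengths, where every circuit solves it vacuously.) [cite: HatamiHozaTalTell2021, Thm. 6.26 (conclusion shape)] -/
def UnsolvableOnLargeTruthTables (Q : PromiseProblem) (P : ∀ n : ℕ, Circuit (Fin n) → Prop) : Prop :=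
  ∀ᶠ ℓ : ℕ in atTop, ∀ E : Circuit (Fin (2 ^ ℓ)), P (2 ^ ℓ) E → ¬ E.SolvesPromise Q

/-- Unfolding: from some `ℓ₀` on, no admissible circuit on `2^ℓ` inputs solves `Q`. [folklore] -/
theorem unsolvableOnLargeTruthTables_iff {Q : PromiseProblem} {P : ∀ n : ℕ, Circuit (Fin n) → Prop} :
    UnsolvableOnLargeTruthTables Q P ↔
      ∃ ℓ₀ : ℕ, ∀ ℓ : ℕ, ℓ₀ ≤ ℓ → ∀ E : Circuit (Fin (2 ^ ℓ)), P (2 ^ ℓ) E → ¬ E.SolvesPromise Q := by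
  unfold UnsolvableOnLargeTruthTables
  rw [eventually_atTop]

/-- **The pointwise bound implies the family bound**: if for all large `ℓ` no `P`-circuit on `2^ℓ`
inputs solves `Q`, then no language of the almost-everywhere class `FamilyAE P` separates `Q`
(a deciding family would solve `Q` at every length, in particular at a large power of two where its
members satisfy `P`). [folklore] -/
theorem UnsolvableOnLargeTruthTables.not_mem_promiseLift {Q : PromiseProblem}
    {P : ∀ n : ℕ, Circuit (Fin n) → Prop} (h : UnsolvableOnLargeTruthTables Q P) :
    Q ∉ promiseLift (FamilyAE P) := by
  rintro ⟨L, ⟨C, ⟨n₀, hn₀⟩, hCL⟩, hy, hn⟩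
  obtain ⟨ℓ₀, hℓ₀⟩ := unsolvableOnLargeTruthTables_iff.1 h
  have hle : n₀ ≤ 2 ^ max ℓ₀ n₀ :=
    (le_max_right ℓ₀ n₀).trans (Nat.lt_two_pow_self).le
  exact hℓ₀ (max ℓ₀ n₀) (le_max_left _ _) (C (2 ^ max ℓ₀ n₀)) (hn₀ _ hle)
    (hCL.solvesPromise hy hn _)

/-- Antitone in the constraint: if from some length on every `P'`-circuit is a `P`-circuit, a bound
against `P`-circuits is a bound against `P'`-circuits. [folklore] -/
theorem UnsolvableOnLargeTruthTables.anti {Q : PromiseProblem} {P P' : ∀ n : ℕ, Circuit (Fin n) → Prop}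
    (h : UnsolvableOnLargeTruthTables Q P)
    (hPP' : ∃ n₀ : ℕ, ∀ n : ℕ, n₀ ≤ n → ∀ E : Circuit (Fin n), P' n E → P n E) :
    UnsolvableOnLargeTruthTables Q P' := by
  obtain ⟨n₀, hn₀⟩ := hPP'
  obtain ⟨ℓ₀, hℓ₀⟩ := unsolvableOnLargeTruthTables_iff.1 h
  refine unsolvableOnLargeTruthTables_iff.2 ⟨max ℓ₀ n₀, fun ℓ hℓ E hE => hℓ₀ ℓ (le_of_max_le_left hℓ) E ?_⟩
  exact hn₀ _ ((le_of_max_le_right hℓ).trans (Nat.lt_two_pow_self).le) E hE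

/-- Monotone in the problem: if from some length on the YES (resp. NO) instances of `Q` are YES
(resp. NO) instances of `R`, then the bound for `Q` gives the bound for `R` (a solver of `R` at a large
length solves `Q` there). [folklore] -/
theorem UnsolvableOnLargeTruthTables.of_imp {Q R : PromiseProblem} {P : ∀ n : ℕ, Circuit (Fin n) → Prop}
    (h : UnsolvableOnLargeTruthTables Q P)
    (hQR : ∃ n₀ : ℕ, ∀ x : List Bool, n₀ ≤ x.length →
      (x ∈ Q.yes → x ∈ R.yes) ∧ (x ∈ Q.no → x ∈ R.no)) :
    UnsolvableOnLargeTruthTables R P := by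
  obtain ⟨n₀, hn₀⟩ := hQR
  obtain ⟨ℓ₀, hℓ₀⟩ := unsolvableOnLargeTruthTables_iff.1 h
  refine unsolvableOnLargeTruthTables_iff.2 ⟨max ℓ₀ n₀, fun ℓ hℓ E hE hsol =>
    hℓ₀ ℓ (le_of_max_le_left hℓ) E hE (hsol.anti ?_ ?_)⟩
  · exact fun x hx hq => (hn₀ x (hx ▸ (le_of_max_le_right hℓ).trans (Nat.lt_two_pow_self).le)).1 hq
  · exact fun x hx hq => (hn₀ x (hx ▸ (le_of_max_le_right hℓ).trans (Nat.lt_two_pow_self).le)).2 hq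

/-! ### The typed statements -/

/-- **Cor. 1.3 at depth `d`**: for all large `ℓ`, no depth-`d` LTF circuit on `n = 2^ℓ` inputs with at
most `⌊n^{1+400^{−d}}⌋` wires solves `gapMCSP[2^{(1−400^{−d})ℓ}, 2^{ℓ−1}/ℓ]`.
[cite: HatamiHozaTalTell2021, Cor. 1.3 (at depth d)] -/
def Cor13At (d : ℕ) : Prop :=
  UnsolvableOnLargeTruthTables (gapProblem (delta d)) (IsLTFd d (powSize (1 + delta d)))

/-- **Thm. 6.26 at the constant depth function `d(n) = d`**: for all large `ℓ`, no depth-`d` LTF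
circuit on `n = 2^ℓ` inputs with at most `⌊n^{1+δ}⌋` wires, `δ = 50^{−d}/8`, solves
`gapMCSP[2^{(1−δ)ℓ}, 2^{ℓ−1}/ℓ]`. [cite: HatamiHozaTalTell2021, Thm. 6.26 (constant d(n) = d)] -/
def Thm626At (d : ℕ) : Prop :=
  UnsolvableOnLargeTruthTables (gapProblem (delta626 d)) (IsLTFd d (powSize (1 + delta626 d)))

/-! ### The named facts (proved in print; used as hypotheses, never asserted) -/

/-- **Hatami–Hoza–Tal–Tell 2021, Corollary 1.3.** Printed (ECCC TR21-002 rev. 1, chunk p0008):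
*"For any constant d ∈ ℕ it holds that gapMCSP[2^{(1−400^{−d})·ℓ}, 2^{ℓ−1}/ℓ] cannot be decided by
LTF circuits of depth d with n^{1+400^{−d}} wires."* Read for every `d ≥ 1` in the pointwise form of
Thm. 6.26 (of which it is the stated special case); rendering: module docstring. A named fact `Prop`.
[cite: HatamiHozaTalTell2021, Cor. 1.3] -/
def cor13 : Prop := ∀ d : ℕ, 1 ≤ d → Cor13At d

/-- **Hatami–Hoza–Tal–Tell 2021, Theorem 6.26, constant-depth case.** Printed (chunk p0110): *"Let
d : ℕ → ℕ be a function with d(n) ≤ (1/6) log log n, let δ(n) = (1/8)·50^{−d(n)}, and assume that d(n)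
can be computed in time O(n^{1−2δ(n)}) … Let s₁(ℓ) = 2^{(1−δ(2^ℓ))·ℓ}, and let s₂(ℓ) = 2^{ℓ−1}/ℓ.
Then for all sufficiently large ℓ and n = 2^ℓ, depth-d(n) LTF circuits with n^{1+δ(n)} wires cannot
solve gapMSCP[s₁, s₂] on truth tables of length n."* Vendored for constant `d(n) = d ≥ 1` only (the
side conditions then hold for all large `n`). A named fact `Prop`.
[cite: HatamiHozaTalTell2021, Thm. 6.26 (constant depth)] -/
def thm626 : Prop := ∀ d : ℕ, 1 ≤ d → Thm626At d

/-! ### Threshold arithmetic -/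

/-- `noThreshold ℓ < CC ⟺ 2^{ℓ−1}/ℓ ≤ CC`: the tree's strict NO side is print's `CC(f) ≥ s₂(ℓ)`.
[folklore] -/
theorem lt_noThreshold_iff (ℓ CC : ℕ) (hℓ : 1 ≤ ℓ) :
    noThreshold ℓ < CC ↔ (2 : ℝ) ^ ((ℓ : ℝ) - 1) / ℓ ≤ CC := by
  have hpos : 0 < (2 : ℝ) ^ ((ℓ : ℝ) - 1) / ℓ := by
    apply div_pos (Real.rpow_pos_of_pos (by norm_num) _)
    exact_mod_cast hℓ
  have hceil : 1 ≤ ⌈(2 : ℝ) ^ ((ℓ : ℝ) - 1) / ℓ⌉₊ := Nat.one_le_iff_ne_zero.2 (by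
    intro h0; rw [Nat.ceil_eq_zero] at h0; exact absurd hpos (not_lt.2 h0))
  unfold noThreshold
  constructor
  · intro h
    have : ⌈(2 : ℝ) ^ ((ℓ : ℝ) - 1) / ℓ⌉₊ ≤ CC := by omega
    exact (Nat.ceil_le).1 this
  · intro h
    have : ⌈(2 : ℝ) ^ ((ℓ : ℝ) - 1) / ℓ⌉₊ ≤ CC := (Nat.ceil_le).2 h
    omega

/-- `CC ≤ yesThreshold δ ℓ ⟺ CC ≤ 2^{(1−δ)ℓ}`: the floor rendering of the YES side is exact. [folklore] -/
theorem le_yesThreshold_iff (δ : ℝ) (ℓ CC : ℕ) :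
    CC ≤ yesThreshold δ ℓ ↔ (CC : ℝ) ≤ (2 : ℝ) ^ ((1 - δ) * ℓ) :=
  Nat.le_floor_iff (Real.rpow_nonneg (by norm_num) _)

/-- `yesThreshold` is antitone in `δ`: a smaller `δ` gives a larger YES threshold. [folklore] -/
theorem yesThreshold_mono {δ δ' : ℝ} (h : δ ≤ δ') (ℓ : ℕ) : yesThreshold δ' ℓ ≤ yesThreshold δ ℓ := by
  unfold yesThreshold
  apply Nat.floor_le_floor
  apply Real.rpow_le_rpow_of_exponent_le (by norm_num)
  have : (0 : ℝ) ≤ ℓ := Nat.cast_nonneg ℓ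
  nlinarith

/-- `powSize` is monotone in the exponent at lengths `n ≥ 1`. [folklore] -/
theorem powSize_mono {κ κ' : ℝ} (h : κ ≤ κ') {n : ℕ} (hn : 1 ≤ n) : powSize κ n ≤ powSize κ' n := by
  unfold powSize
  apply Nat.floor_le_floor
  exact Real.rpow_le_rpow_of_exponent_le (by exact_mod_cast hn) h

/-- `400^{−d} ≤ 50^{−d}/8` for `d ≥ 1` (i.e. `8·50^d ≤ 400^d = 8^d·50^d`). [folklore] -/
theorem delta_le_delta626 {d : ℕ} (hd : 1 ≤ d) : delta d ≤ delta626 d := by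
  unfold delta delta626
  rw [inv_pow, inv_pow, le_div_iff₀ (by norm_num : (0 : ℝ) < 8)]
  have h400 : ((400 : ℝ) ^ d)⁻¹ = ((8 : ℝ) ^ d)⁻¹ * ((50 : ℝ) ^ d)⁻¹ := by
    rw [← mul_inv, ← mul_pow]; norm_num
  rw [h400, mul_comm, ← mul_assoc]
  have h8 : (8 : ℝ) * ((8 : ℝ) ^ d)⁻¹ ≤ 1 := by
    rw [mul_inv_le_iff₀ (by positivity), one_mul]
    calc (8 : ℝ) = 8 ^ 1 := by norm_num
      _ ≤ 8 ^ d := pow_le_pow_right₀ (by norm_num) hd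
  have h50 : 0 ≤ ((50 : ℝ) ^ d)⁻¹ := by positivity
  calc 8 * ((8 : ℝ) ^ d)⁻¹ * ((50 : ℝ) ^ d)⁻¹ ≤ 1 * ((50 : ℝ) ^ d)⁻¹ :=
        mul_le_mul_of_nonneg_right h8 h50
    _ = ((50 : ℝ) ^ d)⁻¹ := one_mul _

/-- `0 < delta d`. [folklore] -/
theorem delta_pos (d : ℕ) : 0 < delta d := by unfold delta; positivity

/-- `delta d ≤ 1`. [folklore] -/
theorem delta_le_one (d : ℕ) : delta d ≤ 1 := by
  unfold delta; rw [inv_pow]; exact inv_le_one_of_one_le₀ (one_le_pow₀ (by norm_num))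

/-! ### Monotonicity of the bound and Cor. 1.3 from Thm. 6.26 -/

/-- The bound for `gapMCSP[yesThreshold δ, noThreshold]` transfers to every problem `gapMCSP[a,
noThreshold]` whose YES threshold is eventually at LEAST `yesThreshold δ` (more YES instances = a
harder problem) — and only in that direction; this is why Cor. 1.3 (`β = 1 − 400^{−d}`) does not reach
the magnification hypothesis at small `β`. [folklore] -/
theorem UnsolvableOnLargeTruthTables.of_yes_le {δ : ℝ} {P : ∀ n : ℕ, Circuit (Fin n) → Prop}
    (h : UnsolvableOnLargeTruthTables (gapProblem δ) P) {a : ℕ → ℕ}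
    (ha : ∃ ℓ₀ : ℕ, ∀ ℓ : ℕ, ℓ₀ ≤ ℓ → yesThreshold δ ℓ ≤ a ℓ) :
    UnsolvableOnLargeTruthTables (gapMCSP a noThreshold) P := by
  obtain ⟨ℓ₀, hℓ₀⟩ := ha
  refine h.of_imp ⟨2 ^ ℓ₀, fun x hx => ⟨fun hq => ?_, fun hq => ?_⟩⟩
  · obtain ⟨n, f, rfl, hf⟩ := hq
    have hn : ℓ₀ ≤ n := by
      rw [length_truthTable] at hx
      exact (Nat.pow_le_pow_iff_right (by norm_num)).1 hx
    exact ⟨n, f, rfl, hf.trans (hℓ₀ n hn)⟩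
  · obtain ⟨n, f, rfl, hf⟩ := hq
    exact ⟨n, f, rfl, hf⟩

/-- `Cor13At` is antitone in the wire budget: fewer wires, easier bound. [folklore] -/
theorem Cor13At.anti_wires {d : ℕ} (h : Cor13At d) {s : ℕ → ℕ}
    (hs : ∃ n₀ : ℕ, ∀ n : ℕ, n₀ ≤ n → s n ≤ powSize (1 + delta d) n) :
    UnsolvableOnLargeTruthTables (gapProblem (delta d)) (IsLTFd d s) := by
  obtain ⟨n₀, hn₀⟩ := hs
  exact h.anti ⟨n₀, fun n hn E hE => ⟨hE.1, hE.2.1, hE.2.2.trans (hn₀ n hn)⟩⟩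

/-- **Cor. 1.3 follows from Thm. 6.26 as rendered** (`d ≥ 1`): Thm. 6.26 has the larger `δ = 50^{−d}/8
≥ 400^{−d}`, hence MORE wires allowed and a SMALLER YES threshold; both changes only strengthen the
bound. [folklore] -/
theorem cor13_of_thm626 (h : thm626) : cor13 := by
  intro d hd
  have hδ := delta_le_delta626 hd
  have h626 := h d hd
  -- weaken the wire budget
  have h1 : UnsolvableOnLargeTruthTables (gapProblem (delta626 d)) (IsLTFd d (powSize (1 + delta d))) :=
    h626.anti ⟨1, fun n hn E hE => ⟨hE.1, hE.2.1, hE.2.2.trans (powSize_mono (by linarith) hn)⟩⟩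
  -- enlarge the YES side
  exact h1.of_yes_le ⟨0, fun ℓ _ => yesThreshold_mono hδ ℓ⟩

/-- Family-class corollary: under Cor. 1.3, for every `d ≥ 1` the problem
`gapMCSP[2^{(1−400^{−d})ℓ}, 2^{ℓ−1}/ℓ]` is separated by NO language of `TCdWIRESae d (wireBound 400 d)`
(the almost-everywhere wires class of rows R44/R49/R62). [folklore] -/
theorem gapProblem_not_mem_promiseLift (h : cor13) {d : ℕ} (hd : 1 ≤ d) :
    gapProblem (delta d) ∉ promiseLift (TCdWIRESae d (ChenTell2019.wireBound 400 d)) := by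
  rw [← powSize_delta_eq_wireBound, ← familyAE_isLTFd]
  exact (h d hd).not_mem_promiseLift

/-! ### Non-vacuity of the constraint (referee rule F1) -/

/-- The constraint `IsLTFd d s` admits the gate-free circuit `x₀` at every length `n ≥ 1`, for every `d`
and `s` (so the typed bound is not vacuously true for want of admissible circuits). [folklore] -/
theorem isLTFd_input (d : ℕ) (s : ℕ → ℕ) (n : ℕ) :
    IsLTFd d s (n + 1) (Circuit.input (0 : Fin (n + 1))) :=
  ⟨Circuit.isOver_input ltfBasis 0,
    by rw [OliveiraSanthanam2018.acDepth_input]; exact Nat.zero_le _,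
    by rw [wires_input]; exact Nat.zero_le _⟩

/-- The YES side of `gapProblem δ` is inhabited at every number of variables `ℓ` when `δ ≤ 1`: the
truth table of a function of circuit size `0` (a projection) is a YES instance, since
`0 ≤ ⌊2^{(1−δ)ℓ}⌋₊`. [folklore] -/
theorem truthTable_mem_yes_of_size_zero {δ : ℝ} {ℓ : ℕ} (f : (Fin ℓ → Bool) → Bool)
    (hf : circuitSizeOver B2 f = 0) : truthTable f ∈ (gapProblem δ).yes := by
  change truthTable f ∈ (gapMCSP (yesThreshold δ) noThreshold).yes
  rw [gapMCSP_yes, truthTable_mem_MCSPSize_iff, hf]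
  exact Nat.zero_le _

end Literature.Computability.MetaComplexity.HatamiHozaTalTell2021

end
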